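import Literature.NumberTheory.EllipticCurves.HeegnerPointsOfConductor
import HarnessLib

/-!
# Route `GenusKolyvaginAtTwo`, crux K₄ `K4Neg` (stmt-BirchSwinnertonDyer-31526) — AT p = 2 KOLYVAGIN'S DERIVATIVE IS A NORM:
# `D_ℓ = 2·D′ + σ·N₂` for `ℓ + 1 = 2k`, hence `P(ℓ) ∈ 2E(K[ℓ]) ⟺ Σ_s s σ (N₂ y(ℓ)) ∈ 2E(K[ℓ])`

LEAD seat `bsd-line-gk2-p1` g25 (cell `bsd-f1-sign2`), `--supports stmt-BirchSwinnertonDyer-31526 --as helper`.  THEOREMS ONLY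
(no definition, no named fact, no `sorry`).  **BSD is NOT proved by this file; K4Neg is NOT proved; nothing is closed.**

SOURCE.  This is piece G1 (+ its prime-level corollary G1′) of the crux idea `derivative-is-genus-at-two`
(seat `cruxidea-stmt-BirchSwinnertonDyer-23491-1`, node `Cruxes/GenusDeepSupplyAtTwoNegDiscNarrow/DerivativeIsGenusNode.md`,
kernel-checked there as `Sketch2.lean`); landed here verbatim in substance so that provers can import it (LEAD-BRIEF-g24 §6:
«bankable regardless»).

THE LEVER.  In `ℤ[G_ℓ]`, `G_ℓ = ⟨σ⟩` of EVEN order `ℓ + 1 = 2k` (every Kolyvagin prime is odd):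

  `D_ℓ = Σ_{i<2k} i σ^i = 2·Σ_{j<k} j (σ^{2j} + σ^{2j+1}) + σ · N₂`,  `N₂ := Σ_{j<k} σ^{2j}`   (†)

(`derivOp_eq_two_nsmul_add`, for the tree's `KolyvaginOperator.derivOp`; monoid action, no commutativity, no `σ^{ℓ+1} = 1`).
Hence for the tree's derived point at a PRIME level `n = ℓ` (`two_dvd_derivedPoint_prime_iff`):

  `(∃ Q, 2•Q = P(ℓ)) ↔ (∃ Q, 2•Q = Σ_{s∈S} s σ (N₂ y(ℓ)))`.

At odd `p` nothing like (†) holds; it is a `p = 2` identity (exact, not a congruence).  ARITHMETIC READING (prose, NOT proved here):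
with the transversal `S ⊂ ker χ_ℓ` the right-hand point is `σ`-conjugate to the genus point `Tr_{K[ℓ]/K(√-ℓ)} y(ℓ)`, so K4Neg at a
prime level is a depth statement about ONE twisted Heegner point (node pieces G2–G6; G6 conjectural).  BSD is NOT proved by any of this.

References: [GrossLMS1991] §3 (3.5), §4 (4.1); [WZhang2014] §3.7.
-/

set_option autoImplicit false
-- the Theorems namespace of this sub repeats the summit name by design (D-0017 nested layout)
set_option linter.dupNamespace false

namespace Summit.BirchSwinnertonDyer.BirchSwinnertonDyer.Theorems.GenusSupplyNarrow.KFourCell.DerivativeIsGenus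

open Finset Literature.NumberTheory.EllipticCurves

/-! ## G1 — the identity (†) for the tree's Kolyvagin operator -/

section Abstract

variable {G : Type*} [Monoid G] {A : Type*} [AddCommMonoid A] (ρ : G →* AddMonoid.End A)

/-- Pairing consecutive terms: `Σ_{i<2k} f i = Σ_{j<k} (f(2j) + f(2j+1))`. [folklore] -/
theorem sum_range_two_mul_eq_sum_pairs (f : ℕ → A) (k : ℕ) :
    ∑ i ∈ range (2 * k), f i = ∑ j ∈ range k, (f (2 * j) + f (2 * j + 1)) := by
  induction k with
  | zero => simp
  | succ k ih =>
    rw [show 2 * (k + 1) = 2 * k + 1 + 1 by ring, sum_range_succ, sum_range_succ, ih,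
      sum_range_succ, add_assoc]

/-- **(†) `D_ℓ = 2·D′ + σ·N₂`** for `ℓ + 1 = 2k`: Kolyvagin's derivative operator of the tree
(`KolyvaginOperator.derivOp ρ σ ℓ y = Σ_{i<ℓ+1} i • σ^i y`) splits as twice an operator plus `σ`
applied to the norm `N₂ y = Σ_{j<k} σ^{2j} y` of the index-2 subgroup.  Monoid action, no
commutativity, no `σ^{ℓ+1} = 1` needed.  BSD is NOT proved by this. [cite: GrossLMS1991, §3 (3.5)] -/
theorem derivOp_eq_two_nsmul_add (σ : G) (y : A) {ℓ k : ℕ} (hk : ℓ + 1 = 2 * k) :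
    KolyvaginOperator.derivOp ρ σ ℓ y =
      2 • (∑ j ∈ range k, j • (ρ (σ ^ (2 * j)) y + ρ (σ ^ (2 * j + 1)) y)) +
        ρ σ (∑ j ∈ range k, ρ (σ ^ (2 * j)) y) := by
  unfold KolyvaginOperator.derivOp
  rw [hk, sum_range_two_mul_eq_sum_pairs, map_sum, Finset.smul_sum, ← sum_add_distrib]
  refine sum_congr rfl fun j _ => ?_
  have hb : ρ (σ ^ (2 * j + 1)) y = ρ σ (ρ (σ ^ (2 * j)) y) := by
    rw [pow_succ', map_mul]; rfl
  rw [← hb, two_mul, add_nsmul, add_nsmul, one_nsmul, add_nsmul, two_nsmul, nsmul_add]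
  abel

end Abstract

/-! ## G1′ — consequence for the tree's derived Heegner point at a prime level -/

section PrimeLevel

variable {A : Type*} [AddCommGroup A]

/-- `2 ∣ 2T + V ↔ 2 ∣ V` in an additive group. [folklore] -/
theorem exists_two_zsmul_eq_add_iff (T V : A) :
    (∃ Q : A, (2 : ℤ) • Q = 2 • T + V) ↔ ∃ Q : A, (2 : ℤ) • Q = V := by
  constructor
  · rintro ⟨Q, hQ⟩
    refine ⟨Q - T, ?_⟩
    rw [smul_sub, hQ, ofNat_zsmul]
    abel
  · rintro ⟨Q, hQ⟩
    refine ⟨Q + T, ?_⟩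
    rw [smul_add, hQ, ofNat_zsmul]
    abel

variable {N : ℕ} [NeZero N] {W : WeierstrassCurve ℚ} {K : Type} [Field K] [NumberField K]
  {Dt : ModularForms.ModularParametrizationData W N} {β : ℤ} {ι : K →+* ℂ}

/-- **`P(ℓ) = 2·(Σ_s s D′ y(ℓ)) + Σ_s s σ (N₂ y(ℓ))`** — the derived point of the tree's
`KolyvaginHeegnerData` at a PRIME level `ℓ` with `ℓ + 1 = 2k`, split along (†).
BSD is NOT proved by this. [cite: GrossLMS1991, §4 (4.1)] -/
theorem derivedPoint_prime_eq_two_nsmul_add {ℓ : ℕ} (hℓ : ℓ.Prime) (d : KolyvaginHeegnerData Dt β ι ℓ)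
    {k : ℕ} (hk : ℓ + 1 = 2 * k) :
    d.derivedPoint =
      2 • (∑ s ∈ d.S, pointGalHom W (ringClassField K ι ℓ) s
        (∑ j ∈ range k, (j • (pointGalHom W (ringClassField K ι ℓ) (d.σ ℓ ^ (2 * j)) d.y +
          pointGalHom W (ringClassField K ι ℓ) (d.σ ℓ ^ (2 * j + 1)) d.y)))) +
      ∑ s ∈ d.S, pointGalHom W (ringClassField K ι ℓ) s
          (pointGalHom W (ringClassField K ι ℓ) (d.σ ℓ)
            (∑ j ∈ range k, pointGalHom W (ringClassField K ι ℓ) (d.σ ℓ ^ (2 * j)) d.y)) := by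
  unfold KolyvaginHeegnerData.derivedPoint KolyvaginOperator.derivedPoint
  rw [Nat.primeFactorsList_prime hℓ, KolyvaginOperator.derivOpProd_cons,
    KolyvaginOperator.derivOpProd_nil, derivOp_eq_two_nsmul_add _ _ _ hk]
  simp only [map_add, map_nsmul, map_sum, sum_add_distrib, Finset.smul_sum]

/-- **Kolyvagin's derived point at a prime level is 2-divisible iff the `σ`-translate of the
`S`-trace of the INDEX-TWO NORM `N₂ y(ℓ)` is** — for the tree's `KolyvaginHeegnerData.derivedPoint`
`P(ℓ) = Σ_{s∈S} s(D_ℓ y(ℓ))`, `ℓ` prime, `ℓ + 1 = 2k`.  (With `S ⊂ ker χ_ℓ` the right-hand point is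
`σ_ℓ`-conjugate to the genus point `Tr_{K[ℓ]/K(√-ℓ)} y(ℓ)`; see the module docstring — NOT proved here.)
BSD is NOT proved by this; K4Neg is NOT proved by this. [cite: GrossLMS1991, §4 (4.1)] -/
theorem two_dvd_derivedPoint_prime_iff {ℓ : ℕ} (hℓ : ℓ.Prime) (d : KolyvaginHeegnerData Dt β ι ℓ)
    {k : ℕ} (hk : ℓ + 1 = 2 * k) :
    (∃ Q, (2 : ℤ) • Q = d.derivedPoint) ↔
      ∃ Q, (2 : ℤ) • Q =
        ∑ s ∈ d.S, pointGalHom W (ringClassField K ι ℓ) s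
          (pointGalHom W (ringClassField K ι ℓ) (d.σ ℓ)
            (∑ j ∈ range k, pointGalHom W (ringClassField K ι ℓ) (d.σ ℓ ^ (2 * j)) d.y)) := by
  rw [derivedPoint_prime_eq_two_nsmul_add hℓ d hk]
  exact exists_two_zsmul_eq_add_iff _ _

/-- **The K4Neg-shaped negation at a prime level**: `P(ℓ) ∉ 2E(K[ℓ]) ⟺ Σ_s s σ (N₂ y(ℓ)) ∉ 2E(K[ℓ])`
(`ℓ` prime, `ℓ + 1 = 2k`) — the form in which K4Neg's conclusion `¬ ∃ Q, 2 • Q = d.derivedPoint` is consumed.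
BSD is NOT proved by this; K4Neg is NOT proved by this. [cite: GrossLMS1991, §4 (4.1)] -/
theorem not_two_dvd_derivedPoint_prime_iff {ℓ : ℕ} (hℓ : ℓ.Prime) (d : KolyvaginHeegnerData Dt β ι ℓ)
    {k : ℕ} (hk : ℓ + 1 = 2 * k) :
    (¬ ∃ Q, (2 : ℤ) • Q = d.derivedPoint) ↔
      ¬ ∃ Q, (2 : ℤ) • Q =
        ∑ s ∈ d.S, pointGalHom W (ringClassField K ι ℓ) s
          (pointGalHom W (ringClassField K ι ℓ) (d.σ ℓ)
            (∑ j ∈ range k, pointGalHom W (ringClassField K ι ℓ) (d.σ ℓ ^ (2 * j)) d.y)) :=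
  (two_dvd_derivedPoint_prime_iff hℓ d hk).not

/-- Every odd prime `ℓ` has `ℓ + 1 = 2k` for `k = (ℓ + 1) / 2` — the shape hypothesis of (†) is met by every Kolyvagin
prime at `2` (these are odd). [folklore] -/
theorem succ_eq_two_mul_of_prime_ne_two {ℓ : ℕ} (hℓ : ℓ.Prime) (h2 : ℓ ≠ 2) : ℓ + 1 = 2 * ((ℓ + 1) / 2) := by
  have hodd : Odd ℓ := hℓ.odd_of_ne_two h2
  obtain ⟨m, rfl⟩ := hodd
  omega

end PrimeLevel

end Summit.BirchSwinnertonDyer.BirchSwinnertonDyer.Theorems.GenusSupplyNarrow.KFourCell.DerivativeIsGenus
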